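import Summits.ABC.ABC.Theses.IsogenyGlueCongruence
import Summits.ABC.ABC.Theorems.IsogenyGlueCongruenceDegreePrimesPolyBoundedStubOldPartner
import Literature.NumberTheory.Automorphic.BCDTModularityModPProofs
import Literature.NumberTheory.Automorphic.CDTTheorem722SerreProofs
import Literature.NumberTheory.EllipticCurves.HasseWeilGoodReductionProofs
import Literature.NumberTheory.EllipticCurves.BSDSelmerPConverseRamifiedProofs
import Literature.NumberTheory.EllipticCurves.RootNumberProofs
import Literature.NumberTheory.GaloisRepresentations.ArtinRepFrobeniusProofs
import Literature.NumberTheory.GaloisRepresentations.ResidualGaloisRep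
import Literature.NumberTheory.DiophantineGeometry.EllArithGlueProofs
import HarnessLib

/-!
# Crux A `DegreePrimesPolyBounded` (stmt-ABC-2045), line `newpart_congruence_friability`:
# stub `stub_oldLevelCongruence`, conditional reshape `stub_oldLevelCongruence_of_galoisFacts`

The registered stub (Galois input of the old-partner peeling `stub_oldPartner_of`; Ribet 1990
§§1–2, DDT 1995 Prop. 2.12(c)) is proved from TWO published facts taken as hypotheses in the tree's
Galois vocabulary — `hMazur`: Mazur 1978 Thm. 4 (semistable `E/ℚ`, `ℓ ≥ 11` ⟹ `E[ℓ]` irreducible;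
the tree's `mazur_isogeny_irreducible` = Thm. 1 misses `ℓ ∈ {11, …, 163}`); `hDS`: Deligne–Serre
1974 Thm. 6.7 in weight `2`, trivial character (semisimple mod-`λ` representation of a
`Γ₀(M)`-newform; tree: `thm67_weightOne` is the weight-one case) — and
everything else is PROVED here: (E0) the congruence in `k = 𝕋_N/𝔪` (`T_q ↦ a_q(W)`; `𝕋 → k`
factors through `χ_g`); (E1) the framed `W[ℓ] ⊗ k` at `q ∤ Nℓ` (tree `IsTorsionGaloisRep` API),
semisimple by Mazur + oddness; (E2) Deligne–Serre Lemme 3.2 mod `ℓ` (kernel form) from the tree's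
PROVED Frobenius density theorem `exists_frob_eq_pow` and Brauer–Nesbitt `brauerNesbitt_holds`;
(E3) so `W[ℓ]` is unramified at `p ∤ Mℓ`; (E4) the Tate-curve criterion (Serre 1968 IV A.1.2) from
the tree's Kodaira–Néron form `exists_inertia_smul_ne_of_hasMultiplicativeReductionAtPrime`.
-/

set_option linter.dupNamespace false

noncomputable section

open scoped MatrixGroups ModularForm NumberField Polynomial Matrix
open CongruenceSubgroup Literature.NumberTheory.EllipticCurves.ModularForms
open Summit.ABC.ABC.Theses.IsogenyGlueCongruence Literature.NumberTheory.GaloisRepresentations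
  Literature.NumberTheory.EllipticCurves Field IsDedekindDomain Rat.HeightOneSpectrum Polynomial

namespace Summit.ABC.ABC.Theorems.DegreePrimesPolyBounded

/-- Cayley–Hamilton for `2 × 2` matrices, `M ^ (j+2) = tr M • M ^ (j+1) - det M • M ^ j`. [folklore] -/
theorem pow_add_two_fin_two {R : Type*} [CommRing R] (M : Matrix (Fin 2) (Fin 2) R) (j : ℕ) :
    M ^ (j + 2) = M.trace • M ^ (j + 1) - M.det • M ^ j := by
  nontriviality R
  have h := Matrix.aeval_self_charpoly M
  rw [Matrix.charpoly_fin_two, map_add, map_sub, map_mul, aeval_C, aeval_C, map_pow, aeval_X,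
    Algebra.algebraMap_eq_smul_one, Algebra.algebraMap_eq_smul_one, smul_one_mul] at h
  have h2 : M ^ 2 = M.trace • M - M.det • (1 : Matrix (Fin 2) (Fin 2) R) := by
    rw [← sub_eq_zero, ← h]; abel
  rw [pow_add, h2, mul_sub, Matrix.mul_smul, Matrix.mul_smul, mul_one, ← pow_succ]

/-- Traces of powers of `2 × 2` matrices are determined by trace and determinant. [folklore] -/
theorem trace_pow_eq_of_trace_eq_of_det_eq {R : Type*} [CommRing R]
    {A B : Matrix (Fin 2) (Fin 2) R} (ht : A.trace = B.trace) (hd : A.det = B.det) (j : ℕ) :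
    (A ^ j).trace = (B ^ j).trace := by
  suffices h : (A ^ j).trace = (B ^ j).trace ∧ (A ^ (j + 1)).trace = (B ^ (j + 1)).trace from h.1
  induction j with
  | zero => exact ⟨by rw [pow_zero, pow_zero], by rw [pow_one, pow_one, ht]⟩
  | succ j ih =>
    refine ⟨ih.2, ?_⟩
    rw [pow_add_two_fin_two A j, pow_add_two_fin_two B j, Matrix.trace_sub, Matrix.trace_sub,
      Matrix.trace_smul, Matrix.trace_smul, Matrix.trace_smul, Matrix.trace_smul, ih.1, ih.2, ht,
      hd]

/-- If `A ^ m = 1 = B ^ m` and `A ^ k`, `B ^ k` (`k` prime to `m`) have the same characteristic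
polynomial, so do the `2 × 2` matrices `A`, `B` (`k k' ≡ 1 (mod m)`, traces of powers). [folklore] -/
theorem charpoly_eq_of_charpoly_pow_eq {K : Type*} [Field K] {A B : Matrix (Fin 2) (Fin 2) K}
    {m k : ℕ} (hm : 0 < m) (hA : A ^ m = 1) (hB : B ^ m = 1) (hk : k.Coprime m)
    (h : (A ^ k).charpoly = (B ^ k).charpoly) : A.charpoly = B.charpoly := by
  set j : ℕ := k ^ (m.totient - 1) with hj
  have hkj : (k * j) % m = 1 % m := by
    have ht : 0 < m.totient := Nat.totient_pos.mpr hm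
    have : k * j = k ^ m.totient := by rw [hj, ← pow_succ', Nat.sub_add_cancel ht]
    rw [this]
    exact Nat.ModEq.pow_totient hk
  have hred : ∀ {X : Matrix (Fin 2) (Fin 2) K}, X ^ m = 1 → (X ^ k) ^ j = X := fun hX ↦ by
    rw [← pow_mul, pow_eq_pow_mod (k * j) hX, hkj, ← pow_eq_pow_mod 1 hX, pow_one]
  have htk : (A ^ k).trace = (B ^ k).trace := by
    rw [Matrix.trace_eq_neg_charpoly_nextCoeff, Matrix.trace_eq_neg_charpoly_nextCoeff, h]
  have hdk : (A ^ k).det = (B ^ k).det := by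
    rw [Matrix.det_eq_sign_charpoly_coeff, Matrix.det_eq_sign_charpoly_coeff, h]
  have ht : A.trace = B.trace := by
    have := trace_pow_eq_of_trace_eq_of_det_eq htk hdk j
    rwa [hred hA, hred hB] at this
  have hdet : A.det = B.det := by
    rw [← hred hA, ← hred hB, Matrix.det_pow (A ^ k) j, Matrix.det_pow (B ^ k) j, hdk]
  rw [Matrix.charpoly_fin_two, Matrix.charpoly_fin_two, ht, hdet]

/-- **Deligne–Serre 1974, Lemme 3.2, modulo `ℓ` (kernel form), PROVED.** Two semisimple plane
representations `ρ₁, ρ₂ : Γ_ℚ →ₜ* GL₂(k)`, `k` a discrete field, with the same Frobenius characteristic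
polynomials outside a finite `S` have the same kernel. Printed: Chebotarev + Brauer–Nesbitt; here
Frobenius' density theorem (tree `exists_frob_eq_pow`, on `ρ₁ × ρ₂`: `ρᵢ τ = ρᵢ g ^ n`, `(n, ord) = 1`)
suffices as characteristic polynomials see all powers (`charpoly_eq_of_charpoly_pow_eq`), and
Brauer–Nesbitt is the tree's `brauerNesbitt_holds`. [cite: DeligneSerreASENS1974, Lemme 3.2 (p. 513)] -/
theorem apply_eq_one_iff_of_hasFrobCharpolyAt {k : Type} [Field k] [TopologicalSpace k]
    [DiscreteTopology k] (ρ₁ ρ₂ : FramedGaloisRep ℚ k 2)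
    (h₁ : (FramedRep.toRepresentation ρ₁).IsSemisimpleRepresentation)
    (h₂ : (FramedRep.toRepresentation ρ₂).IsSemisimpleRepresentation) (S : Finset ℕ)
    (hS : ∀ v : HeightOneSpectrum (𝓞 ℚ), ((primesEquiv v : Nat.Primes) : ℕ) ∉ S →
      ∃ P : k[X], ρ₁.HasFrobCharpolyAt v P ∧ ρ₂.HasFrobCharpolyAt v P)
    (σ : absoluteGaloisGroup ℚ) : ρ₁ σ = 1 ↔ ρ₂ σ = 1 := by
  classical
  set π : absoluteGaloisGroup ℚ →* GL (Fin 2) k × GL (Fin 2) k :=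
    (ρ₁ : absoluteGaloisGroup ℚ →* GL (Fin 2) k).prod (ρ₂ : absoluteGaloisGroup ℚ →* GL (Fin 2) k)
    with hπ
  set φ : absoluteGaloisGroup ℚ →* π.range := π.rangeRestrict with hφ
  have hφsurj : Function.Surjective φ := MonoidHom.rangeRestrict_surjective π
  have hφ_coe : ∀ τ, ((φ τ : π.range) : GL (Fin 2) k × GL (Fin 2) k) = (ρ₁ τ, ρ₂ τ) := fun τ ↦ rfl
  have hker : IsOpen ((φ.ker : Subgroup (absoluteGaloisGroup ℚ)) : Set (absoluteGaloisGroup ℚ)) := by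
    have : ((φ.ker : Subgroup (absoluteGaloisGroup ℚ)) : Set (absoluteGaloisGroup ℚ)) =
        ρ₁ ⁻¹' {1} ∩ ρ₂ ⁻¹' {1} := by
      ext τ
      simp only [SetLike.mem_coe, MonoidHom.mem_ker, Set.mem_inter_iff, Set.mem_preimage,
        Set.mem_singleton_iff, ← Subtype.coe_inj, hφ_coe, OneMemClass.coe_one, Prod.mk_eq_one]
    rw [this]
    exact ((isOpen_discrete _).preimage (map_continuous ρ₁)).inter
      ((isOpen_discrete _).preimage (map_continuous ρ₂))
  haveI : Finite (absoluteGaloisGroup ℚ ⧸ φ.ker) := Subgroup.quotient_finite_of_isOpen _ hker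
  haveI : Finite π.range :=
    Finite.of_surjective _ (QuotientGroup.quotientKerEquivOfSurjective φ hφsurj).surjective
  have hcomp : ∀ (g : absoluteGaloisGroup ℚ) (n : ℕ),
      ((φ g ^ n : π.range) : GL (Fin 2) k × GL (Fin 2) k) = (ρ₁ g ^ n, ρ₂ g ^ n) := fun g n ↦ by
    rw [SubmonoidClass.coe_pow, hφ_coe, Prod.pow_mk]
  -- equal characteristic polynomials everywhere (Frobenius density + the power trick)
  have hchar : ∀ g : absoluteGaloisGroup ℚ,
      ((ρ₁ g : GL (Fin 2) k) : Matrix (Fin 2) (Fin 2) k).charpoly =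
        ((ρ₂ g : GL (Fin 2) k) : Matrix (Fin 2) (Fin 2) k).charpoly := by
    intro g
    obtain ⟨v, hvS, 𝔓, h𝔓, τ, hτ, n, hn, hφτ⟩ := DeligneSerre1974.exists_frob_eq_pow φ hker S g
    obtain ⟨P, hP₁, hP₂⟩ := hS v hvS
    have e₁ := hP₁ 𝔓 h𝔓 τ hτ
    have e₂ := hP₂ 𝔓 h𝔓 τ hτ
    simp only [FramedRep.charpoly] at e₁ e₂
    have hτn := congrArg Subtype.val hφτ
    rw [hφ_coe, hcomp, Prod.mk.injEq] at hτn
    have hm := congrArg Subtype.val (pow_orderOf_eq_one (φ g))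
    rw [hcomp, OneMemClass.coe_one, Prod.mk_eq_one] at hm
    refine charpoly_eq_of_charpoly_pow_eq (orderOf_pos (φ g)) ?_ ?_ hn ?_
    · rw [← Units.val_pow_eq_pow_val, hm.1, Units.val_one]
    · rw [← Units.val_pow_eq_pow_val, hm.2, Units.val_one]
    · rw [← Units.val_pow_eq_pow_val, ← Units.val_pow_eq_pow_val, ← hτn.1, ← hτn.2]
      exact e₁.trans e₂.symm
  -- Brauer–Nesbitt: the two semisimple representations are equivalent
  have hrep : ∀ (ρ : FramedGaloisRep ℚ k 2) (g : absoluteGaloisGroup ℚ),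
      FramedRep.toRepresentation ρ g =
        Matrix.toLin' ((ρ g : GL (Fin 2) k) : Matrix (Fin 2) (Fin 2) k) :=
    fun ρ g ↦ LinearMap.ext fun w ↦ by simp [Matrix.toLin'_apply]
  obtain ⟨e⟩ := brauerNesbitt_holds (FramedRep.toRepresentation ρ₁) (FramedRep.toRepresentation ρ₂)
    h₁ h₂ (fun g ↦ by rw [hrep, hrep, Matrix.charpoly_toLin', Matrix.charpoly_toLin']; exact hchar g)
  have key : ∀ {ρ ρ' : FramedGaloisRep ℚ k 2}
      (e : (FramedRep.toRepresentation ρ).Equiv (FramedRep.toRepresentation ρ')),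
      ρ' σ = 1 → ρ σ = 1 := by
    intro ρ ρ' e h
    have hv : ∀ w : Fin 2 → k, ((ρ σ : GL (Fin 2) k) : Matrix (Fin 2) (Fin 2) k) *ᵥ w = w := by
      intro w
      apply e.toLinearEquiv.injective
      have := Representation.IntertwiningMap.isIntertwining _ _ e.toIntertwiningMap σ w
      rw [FramedRep.toRepresentation_apply_apply, FramedRep.toRepresentation_apply_apply, h,
        Units.val_one, Matrix.one_mulVec] at this
      exact this
    refine Matrix.GeneralLinearGroup.ext fun i i' ↦ ?_
    have hij := congrFun (hv (Pi.single i' 1)) i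
    rw [Matrix.mulVec_single_one] at hij
    change ((ρ σ : GL (Fin 2) k) : Matrix (Fin 2) (Fin 2) k) i i' = _ at hij
    rw [hij, Units.val_one, Matrix.one_apply, Pi.single_apply]
  exact ⟨key e.symm, key e⟩

/-- A framed model `ρ̄` of `W[ℓ]` is unramified at a place `v` over a prime `q ∤ N_W ℓ`, with
`charpoly ρ̄(Frob_v) = X² − a_q(W) X + q (mod ℓ)` (good reduction at `q ∤ N_W`; Silverman VII.4.1(a),
C.21.3: tree `IsTorsionGaloisRep.isUnramifiedAt_of_hasGoodReductionAt`, `charpoly_eq_of_isArithFrobAt`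
with the discharged trace/determinant of Frobenius on `T_ℓ E`). [folklore] -/
theorem isUnramifiedAt_and_hasFrobCharpolyAt_of_isTorsionGaloisRep {W : WeierstrassCurve ℚ}
    [W.IsElliptic] {ℓ : ℕ} [Fact ℓ.Prime] {ρ : FramedGaloisRep ℚ (ZMod ℓ) 2}
    (hρ : W.IsTorsionGaloisRep ℓ ρ) {v : HeightOneSpectrum (𝓞 ℚ)}
    (hvN : ¬ ((primesEquiv v : Nat.Primes) : ℕ) ∣ W.conductorNorm ℤ)
    (hvℓ : ((primesEquiv v : Nat.Primes) : ℕ) ≠ ℓ) :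
    ρ.IsUnramifiedAt v ∧ ρ.HasFrobCharpolyAt v
      (X ^ 2 - C ((W.LFunction ((primesEquiv v : Nat.Primes) : ℕ) : ℤ) : ZMod ℓ) * X +
        C ((((primesEquiv v : Nat.Primes) : ℕ) : ZMod ℓ))) := by
  have hℓ : ℓ.Prime := Fact.out
  have hgood : W.HasGoodReductionAt v := by_contra fun h ↦ hvN ((W.dvd_conductorNorm_iff v).mpr h)
  have hℓv : ((ℓ : ℕ) : 𝓞 ℚ) ∉ v.asIdeal := by
    rw [Rat.natCast_mem_asIdeal_iff]
    exact fun h ↦ hvℓ ((Nat.prime_dvd_prime_iff_eq (primesEquiv v).2 hℓ).mp h)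
  refine ⟨hρ.isUnramifiedAt_of_hasGoodReductionAt hgood hℓv, fun 𝔓 h𝔓 σ hσ ↦ ?_⟩
  have hch := hρ.charpoly_eq_of_isArithFrobAt
    (W.trace_galoisRepTate_frobenius_of_hasGoodReductionAt_holds ℓ)
    (W.det_galoisRepTate_frobenius_of_hasGoodReductionAt_holds ℓ) hℓv hgood h𝔓 hσ
  rw [WeierstrassCurve.natCard_residueField_adicCompletionIntegers,
    ← W.lFunction_primesEquiv_eq_frobeniusTraceAt hgood] at hch
  simp only [FramedRep.charpoly, hch]

/-- **Tate-curve criterion, unramified direction, PROVED** (Serre 1968, IV A.1.2; *ATAEC* V,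
Ex. 5.13(b)): for `W/ℚ` elliptic, globally minimal, multiplicative at the prime `p`, a prime `ℓ ≠ p`
and a framed model of `W[ℓ]` unramified at `p`, `ℓ ∣ v_p(Δ_min(W))` — from the tree's Kodaira–Néron
form "`ℓ ∤ v_p(Δ_min)` ⟹ a local inertia element moves an `ℓ`-torsion point of `E(\bar ℚ_p)`"
(`exists_inertia_smul_ne_of_hasMultiplicativeReductionAtPrime`), local inertia restricting into global
inertia (`resGalOfEmb_mem_inertia_primeBelow`), torsion being algebraic (`exists_pointsMapOfEmb_…`).
[cite: SerreAbelianLadic1968, Ch. IV, A.1.2] [cite: SilvermanATAEC1994, Exercise 5.13(b) (PDF p. 416)] -/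
theorem dvd_factorization_minimalDiscriminantNorm_of_isUnramifiedAt (W : WeierstrassCurve ℚ)
    [W.IsElliptic] [W.IsGloballyMinimal] {p ℓ : ℕ} (hp : p.Prime) [Fact ℓ.Prime] (hpℓ : p ≠ ℓ)
    (hmult : W.HasMultiplicativeReductionAt ((primesEquiv (R := ℤ)).symm ⟨p, hp⟩))
    {ρ : FramedGaloisRep ℚ (ZMod ℓ) 2} (hρ : W.IsTorsionGaloisRep ℓ ρ)
    (hunr : ρ.IsUnramifiedAt ((primesEquiv (R := 𝓞 ℚ)).symm ⟨p, hp⟩)) :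
    ℓ ∣ (W.minimalDiscriminantNorm ℤ).factorization p := by
  have hℓ : ℓ.Prime := Fact.out
  by_contra hndvd
  set u : HeightOneSpectrum ℤ := (primesEquiv (R := ℤ)).symm ⟨p, hp⟩ with hudef
  have hup : ((primesEquiv u : Nat.Primes) : ℕ) = p :=
    congrArg Subtype.val (Equiv.apply_symm_apply _ _)
  set v : HeightOneSpectrum (𝓞 ℚ) := (primesEquiv (R := 𝓞 ℚ)).symm ⟨p, hp⟩ with hvdef
  have hvp : ((primesEquiv v : Nat.Primes) : ℕ) = p :=
    congrArg Subtype.val (Equiv.apply_symm_apply _ _)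
  have key : ∀ (q q' : ℕ) (hq : Fact q.Prime) (hq' : Fact q'.Prime), q = q' →
      @WeierstrassCurve.HasMultiplicativeReductionAtPrime W q hq →
        @WeierstrassCurve.HasMultiplicativeReductionAtPrime W q' hq' := by rintro q q' hq hq' rfl h; exact h
  have hmultv : haveI := Fact.mk (primesEquiv v).2;
      W.HasMultiplicativeReductionAtPrime (primesEquiv v) := key _ _ _ _ (hup.trans hvp.symm)
    ((W.hasMultiplicativeReductionAtPrime_primesEquiv_iff_hasMultiplicativeReductionAt u).mpr hmult)
  have hram : ¬ ℓ ∣ padicValNat (primesEquiv v) W.minimalDiscriminantInt.natAbs := by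
    rwa [hvp, ← WeierstrassCurve.minimalDiscriminantNorm_int_eq_natAbs_minimalDiscriminantInt_holds W,
      ← Nat.factorization_def _ hp]
  have hpℓ' : ((primesEquiv v : Nat.Primes) : ℕ) ≠ ℓ := by rw [hvp]; exact hpℓ
  obtain ⟨w, hw⟩ := v.exists_spectralValuation
  obtain ⟨𝔐, h𝔐⟩ := v.localPrimesAbove_nonempty
  obtain ⟨σ, hσ, Q, hQ, hne⟩ :=
    W.exists_inertia_smul_ne_of_hasMultiplicativeReductionAtPrime v hℓ hpℓ' hmultv hram hw h𝔐
  set ι := closureEmb (K := ℚ) (v.adicCompletion ℚ) with hι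
  obtain ⟨P, hP, rfl⟩ := exists_pointsMapOfEmb_eq_of_nsmul_eq_zero W ι hℓ.ne_zero hQ
  have h1 : ρ (resGalOfEmb ι σ) = 1 :=
    hunr _ (HeightOneSpectrum.primeBelow_mem_primesAbove h𝔐) _
      (v.resGalOfEmb_mem_inertia_primeBelow ι 𝔐 hσ)
  obtain ⟨e, he⟩ := hρ
  have hPmem : P ∈ WeierstrassCurve.geomTorsion W (ℓ : ℕ) :=
    (Submodule.mem_torsionBy_iff _ _).mpr (by rw [natCast_zsmul]; exact hP)
  have hfix : resGalOfEmb ι σ • P = P := by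
    have h2 := he (resGalOfEmb ι σ) ⟨P, hPmem⟩
    rw [h1, Units.val_one, Matrix.one_mulVec] at h2
    exact congrArg Subtype.val (e.injective h2)
  exact hne (by rw [← pointsMapOfEmb_smul, hfix])

/-- **Stub `stub_oldLevelCongruence`, conditional form** (registered reshape): an old-level
congruence prime `ℓ ≥ 11`, `ℓ ∤ N`, of the newform of a semistable minimal `W` of conductor `N` with a
newform of level `M ∣ N` divides `v_p(Δ_min(W))`, `p ∣ N`, `p ∤ M` (Ribet 1990 §§1–2; DDT 1995
Prop. 2.12(c)), from `hMazur` = Mazur 1978 Thm. 4 (semistable `E`, prime `ℓ ≥ 11` ⟹ `E[ℓ]`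
irreducible) and `hDS` = Deligne–Serre 1974 Thm. 6.7 in weight `2`, trivial character (semisimple
mod-`λ` representation of a `Γ₀(M)`-newform `g` over any field `k` of characteristic `ℓ` receiving the
`a_q(g)`, `q ∉ S ⊇ {q ∣ Mℓ}`: unramified outside `Mℓ`, `charpoly(Frob_q) = X² − a_q X + q`, `q ∉ S`;
the `a_q`, `q ∉ S`, generate the residue field by Chebotarev). All else is proved above.
[cite: Ribet1990, §§1–2] [cite: Mazur1978, Thm. 4] [cite: DeligneSerreASENS1974, Thm. 6.7] -/
theorem stub_oldLevelCongruence_of_galoisFacts :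
    (∀ (W : WeierstrassCurve ℚ) [W.IsElliptic], W.IsSemistable ℤ →
      ∀ ℓ : ℕ, ℓ.Prime → 11 ≤ ℓ → W.HasIrreducibleModPGaloisRep ℓ) →
    (∀ (M : ℕ) [NeZero M] (g : CuspForm (Gamma0 M) 2), IsNewform0 g →
      ∀ (ℓ : ℕ) [Fact ℓ.Prime] (S : Finset ℕ), (∀ q : ℕ, q.Prime → q ∣ M * ℓ → q ∈ S) →
      ∀ (R : Subring ℂ)
        (hR : ∀ q : ℕ, q.Prime → q ∉ S → (UpperHalfPlane.qExpansion 1 ⇑g).coeff q ∈ R)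
        (k : Type) [Field k] [CharP k ℓ] [TopologicalSpace k] [DiscreteTopology k]
        (ψ : R →+* k),
      ∃ ρ : Literature.NumberTheory.GaloisRepresentations.FramedGaloisRep ℚ k 2,
        ρ.toGaloisRep.IsSemisimple ∧
        (∀ v : IsDedekindDomain.HeightOneSpectrum (NumberField.RingOfIntegers ℚ),
          ¬ ((Rat.HeightOneSpectrum.primesEquiv v : Nat.Primes) : ℕ) ∣ M * ℓ → ρ.IsUnramifiedAt v) ∧
        ∀ (v : IsDedekindDomain.HeightOneSpectrum (NumberField.RingOfIntegers ℚ))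
          (hv : ((Rat.HeightOneSpectrum.primesEquiv v : Nat.Primes) : ℕ) ∉ S),
          ρ.HasFrobCharpolyAt v (Polynomial.X ^ 2 - Polynomial.C (ψ
            ⟨(UpperHalfPlane.qExpansion 1 ⇑g).coeff ((Rat.HeightOneSpectrum.primesEquiv v : Nat.Primes) : ℕ),
              hR _ (Rat.HeightOneSpectrum.primesEquiv v).2 hv⟩) * Polynomial.X +
            Polynomial.C ((((Rat.HeightOneSpectrum.primesEquiv v : Nat.Primes) : ℕ) : k)))) →
    ∀ (N : ℕ) [NeZero N] (W : WeierstrassCurve ℚ) [W.IsElliptic] [W.IsGloballyMinimal],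
    W.IsSemistable ℤ → W.conductorNorm ℤ = N →
    ∀ (f : CuspForm (Gamma0 N) 2), IsNewformOf W f →
    ∀ (M : ℕ) [NeZero M] (hM : M ∣ N) (g : CuspForm (Gamma0 M) 2), IsNewform0 g →
    ∀ (p ℓ : ℕ), p.Prime → ℓ.Prime → p ∣ N → ¬ p ∣ M → ¬ ℓ ∣ N → 11 ≤ ℓ →
    ∀ 𝔪 : Ideal (anemicHeckeRing N 2), 𝔪.IsMaximal → (ℓ : anemicHeckeRing N 2) ∈ 𝔪 →
      eigenIdeal f ≤ 𝔪 → eigenIdeal (toLevel0 hM 2 g) ≤ 𝔪 →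
      ℓ ∣ (W.minimalDiscriminantNorm ℤ).factorization p := by
  intro hMazur hDS N _ W _ _ hW hN f hf M _ hM g hg p ℓ hp hℓ hpN hpM hℓN h11 𝔪 h𝔪 hℓ𝔪 hf𝔪 hg𝔪
  haveI : Fact ℓ.Prime := ⟨hℓ⟩
  have hℓ2 : ℓ ≠ 2 := by omega
  have hpℓ : p ≠ ℓ := fun h ↦ hℓN (h ▸ hpN)
  have hpMℓ : ¬ p ∣ M * ℓ := fun h ↦ (hp.dvd_mul.mp h).elim hpM
    fun h' ↦ hpℓ ((Nat.prime_dvd_prime_iff_eq hp hℓ).mp h')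
  let k : Type := anemicHeckeRing N 2 ⧸ 𝔪
  letI : Field k := Ideal.Quotient.field 𝔪
  letI : TopologicalSpace k := ⊥
  haveI : DiscreteTopology k := ⟨rfl⟩
  haveI : CharP k ℓ := charP_quotient_of_natCast_mem h𝔪 hℓ hℓ𝔪
  -- (E0) the congruence: `T_q ↦ a_q(W)` in `k`, and `𝕋 → k` factors through `χ_g`
  have hTq : ∀ (q : ℕ) (hq : q.Prime) (hqN : ¬ q ∣ N),
      (haveI : NeZero q := ⟨hq.ne_zero⟩
       Ideal.Quotient.mk 𝔪 (anemicHeckeRing.T N 2 q hq hqN) = ((W.LFunction q : ℤ) : k)) := by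
    intro q hq hqN
    haveI : NeZero q := ⟨hq.ne_zero⟩
    have hc : heckeT (Gamma0 N) 2 q f = ((W.LFunction q : ℤ) : ℂ) • f := by
      rw [hf.1.heckeT_eq_coeff_smul hq]
      exact congrArg (· • f) (hf.2 q)
    have h := hf𝔪 (T_sub_intCast_mem_eigenIdeal hq hqN hc)
    rwa [← Ideal.Quotient.eq_zero_iff_mem, map_sub, sub_eq_zero, map_intCast] at h
  set χ := eigencharacter (isAnemicEigenvector_toLevel0_and_ne_zero hM hg).1
    (isAnemicEigenvector_toLevel0_and_ne_zero hM hg).2 with hχ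
  have hχT : ∀ (q : ℕ) (hq : q.Prime) (hqN : ¬ q ∣ N),
      (haveI : NeZero q := ⟨hq.ne_zero⟩
       χ (anemicHeckeRing.T N 2 q hq hqN) = (UpperHalfPlane.qExpansion 1 ⇑g).coeff q) := by
    intro q hq hqN
    haveI : NeZero q := ⟨hq.ne_zero⟩
    exact eigencharacter_eq_of_apply_eq_smul _ _
      (by rw [anemicHeckeRing.coe_T]; exact heckeT_toLevel0_eq_coeff_smul' hM hg q hq hqN)
  have hsurj : Function.Surjective χ.rangeRestrict := RingHom.rangeRestrict_surjective χ
  have hker : RingHom.ker χ.rangeRestrict ≤ RingHom.ker (Ideal.Quotient.mk 𝔪) := by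
    rw [RingHom.ker_rangeRestrict, Ideal.mk_ker, hχ, ← eigenIdeal_eq_ker_eigencharacter]; exact hg𝔪
  obtain ⟨ψ, hψ⟩ : ∃ ψ : χ.range →+* k, ∀ t, ψ (χ.rangeRestrict t) = Ideal.Quotient.mk 𝔪 t :=
    ⟨χ.rangeRestrict.liftOfRightInverse _ (Function.rightInverse_surjInv hsurj)
      ⟨Ideal.Quotient.mk 𝔪, hker⟩, fun t ↦ RingHom.liftOfRightInverse_comp_apply _ _ _ _ t⟩
  set S : Finset ℕ := (N * ℓ).primeFactors with hS
  have hNℓ0 : N * ℓ ≠ 0 := mul_ne_zero (NeZero.ne N) hℓ.ne_zero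
  have hmemS : ∀ q : ℕ, q.Prime → (q ∈ S ↔ q ∣ N * ℓ) := fun q hq ↦ by
    rw [hS, Nat.mem_primeFactors]; exact ⟨fun h ↦ h.2.1, fun h ↦ ⟨hq, h, hNℓ0⟩⟩
  have hSM : ∀ q : ℕ, q.Prime → q ∣ M * ℓ → q ∈ S := fun q hq h ↦
    (hmemS q hq).mpr (h.trans (mul_dvd_mul_right hM ℓ))
  have hqN_of : ∀ q : ℕ, q.Prime → q ∉ S → ¬ q ∣ N := fun q hq hqS h ↦
    hqS ((hmemS q hq).mpr (dvd_mul_of_dvd_left h ℓ))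
  have hR : ∀ q : ℕ, q.Prime → q ∉ S → (UpperHalfPlane.qExpansion 1 ⇑g).coeff q ∈ χ.range :=
    fun q hq hqS ↦ ⟨_, hχT q hq (hqN_of q hq hqS)⟩
  obtain ⟨ρg, hgss, hgunr, hgfrob⟩ := hDS M g hg ℓ S hSM χ.range hR k ψ
  have hψa : ∀ (q : ℕ) (hq : q.Prime) (hqS : q ∉ S),
      ψ ⟨(UpperHalfPlane.qExpansion 1 ⇑g).coeff q, hR q hq hqS⟩ = ((W.LFunction q : ℤ) : k) := by
    intro q hq hqS
    have hqN := hqN_of q hq hqS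
    haveI : NeZero q := ⟨hq.ne_zero⟩
    rw [← hTq q hq hqN, ← hψ]
    congr 1
    exact Subtype.ext (hχT q hq hqN).symm
  -- (E1) the framed `W[ℓ]`, base-changed to `k`; semisimple by Mazur (`ℓ ≥ 11`) and oddness
  haveI : NeZero ((ℓ : ℕ) : ℚ) := ⟨by exact_mod_cast hℓ.ne_zero⟩
  obtain ⟨ρW, hρW⟩ := W.exists_isTorsionGaloisRep ℓ
  let j : ZMod ℓ →+* k := ZMod.castHom (dvd_refl ℓ) k
  obtain ⟨ρ₁, hρ₁, h₁⟩ : ∃ ρ₁ : FramedGaloisRep ℚ k 2,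
      (∀ σ, ρ₁ σ = Matrix.GeneralLinearGroup.map j (ρW σ)) ∧
        (FramedRep.toRepresentation ρ₁).IsSemisimpleRepresentation := by
    refine ⟨FramedRep.baseChange j continuous_of_discreteTopology ρW, fun σ ↦ rfl, ?_⟩
    haveI := Literature.NumberTheory.Automorphic.BCDT.isAbsolutelyIrreducible_of_hasIrreducibleModPGaloisRep
      W hℓ2 (hMazur W hW ℓ hℓ h11) hρW k j
    rw [FramedRep.toRepresentation_baseChange]
    infer_instance
  have hfrob : ∀ v : HeightOneSpectrum (𝓞 ℚ), ((primesEquiv v : Nat.Primes) : ℕ) ∉ S →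
      ∃ P : k[X], ρ₁.HasFrobCharpolyAt v P ∧ ρg.HasFrobCharpolyAt v P := by
    intro v hvS
    have hq := (primesEquiv v).2
    refine ⟨_, ?_, hgfrob v hvS⟩
    rw [hψa _ hq hvS]
    have hvN : ¬ ((primesEquiv v : Nat.Primes) : ℕ) ∣ W.conductorNorm ℤ := by
      rw [hN]; exact hqN_of _ hq hvS
    have hvℓ : ((primesEquiv v : Nat.Primes) : ℕ) ≠ ℓ := fun h ↦
      hvS ((hmemS _ hq).mpr (h ▸ dvd_mul_left ℓ N))
    obtain ⟨-, hW2⟩ := isUnramifiedAt_and_hasFrobCharpolyAt_of_isTorsionGaloisRep hρW hvN hvℓ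
    intro 𝔓 h𝔓 σ hσ
    have hch := hW2 𝔓 h𝔓 σ hσ
    simp only [FramedRep.charpoly] at hch ⊢
    have hmap : (Units.val (Matrix.GeneralLinearGroup.map j (ρW σ)) : Matrix (Fin 2) (Fin 2) k) =
        ((ρW σ : GL (Fin 2) (ZMod ℓ)) : Matrix (Fin 2) (Fin 2) (ZMod ℓ)).map j := rfl
    rw [hρ₁ σ, hmap, Matrix.charpoly_map, hch]
    simp only [Polynomial.map_add, Polynomial.map_sub, Polynomial.map_mul, Polynomial.map_pow,
      Polynomial.map_X, map_intCast, map_natCast, Polynomial.map_intCast, Polynomial.map_natCast]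
  -- (E2)–(E3): `ρ_W ⊗ k` and `ρ_g` have the same kernel, so `W[ℓ]` is unramified at `p ∤ M ℓ`
  have hkey := apply_eq_one_iff_of_hasFrobCharpolyAt ρ₁ ρg h₁ hgss S hfrob
  have hvp : ((primesEquiv ((primesEquiv (R := 𝓞 ℚ)).symm ⟨p, hp⟩) : Nat.Primes) : ℕ) = p :=
    congrArg Subtype.val (Equiv.apply_symm_apply _ _)
  have hunr : ρW.IsUnramifiedAt ((primesEquiv (R := 𝓞 ℚ)).symm ⟨p, hp⟩) := by
    intro 𝔓 h𝔓 σ hσ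
    have hg1 : ρg σ = 1 := hgunr _ (by rw [hvp]; exact hpMℓ) 𝔓 h𝔓 σ hσ
    have h1 : ρ₁ σ = 1 := (hkey σ).mpr hg1
    rw [hρ₁ σ] at h1
    have hjinj : Function.Injective j := ZMod.castHom_injective k
    have h1' := Units.ext_iff.mp h1
    rw [Units.val_one] at h1'
    have h2 : ∀ i i', j (((ρW σ : GL (Fin 2) (ZMod ℓ)) : Matrix (Fin 2) (Fin 2) (ZMod ℓ)) i i') =
        (1 : Matrix (Fin 2) (Fin 2) k) i i' := fun i i' ↦ congrFun (congrFun h1' i) i'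
    refine Matrix.GeneralLinearGroup.ext fun i i' ↦ ?_
    apply hjinj
    rw [h2, Units.val_one, Matrix.one_apply, Matrix.one_apply]
    split_ifs <;> simp
  -- (E4) multiplicative reduction at `p ∣ N` (semistability) and the Tate-curve criterion
  have hmult : W.HasMultiplicativeReductionAt ((primesEquiv (R := ℤ)).symm ⟨p, hp⟩) := by
    have hsv := hW ((primesEquiv (R := ℤ)).symm ⟨p, hp⟩)
    rw [WeierstrassCurve.IsSemistableAt] at hsv
    rcases hsv with hgood | hm
    · exfalso
      have h0 := (WeierstrassCurve.conductorExponent_eq_zero_iff_holds _ W).mpr hgood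
      have h1 := factorization_conductorNorm_eq_conductorExponent W ⟨p, hp⟩
      rw [h0, hN] at h1
      exact (hp.factorization_pos_of_dvd (NeZero.ne N) hpN).ne' h1
    · exact hm
  exact dvd_factorization_minimalDiscriminantNorm_of_isUnramifiedAt W hp hpℓ hmult hρW hunr

end Summit.ABC.ABC.Theorems.DegreePrimesPolyBounded

end
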